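import Literature.NumberTheory.EllipticCurves.ZpExtensionEisensteinSelmerStructureProofs
import Literature.NumberTheory.EllipticCurves.ZpExtensionEisensteinAdicTower
import HarnessLib

/-!
# `lim_k H¹_{F_𝔮}(K, T_𝔮/p^k)` of the typed tower (`Howard2004.AdicTower.limitSelmer`) IS the pinned `H¹_{F_𝔮}(K, T_𝔮)`
# (`EisensteinH1Data.ordinarySelmer` of `eisensteinH1Limit`) — glue theorems only

Topic `NumberTheory/EllipticCurves` (D1 road of cell `pub/bsd-print-x9`). The two currencies for Howard's
`H¹_{F_𝔮}(K, T_𝔮)` [Howard 2004, §1.6 / §2.2, arXiv 1202.6340 p. 12, L29–55: `H¹_F(K, T) = lim_k H¹_F(K, T/𝔪^k T)`]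
now both exist in the tree:

* typed (lit's §F/(W9)): `(κ.eisensteinAdicTower ρ t hm ht).limitSelmer F` for the Eisenstein tower
  (`ZpExtensionEisensteinAdicTower`, x9-p1-w3) and a level-wise family `F` of Selmer structures;
* pinned (D1): `(κ.eisensteinH1Limit ρ t hm).ordinarySelmer S Φ` (`ZpExtensionEisensteinSelmerStructure`), with
  `F = κ.eisensteinSelmerStructure ρ t hm S Φ` Howard's `F_𝔮`.

This file records that they coincide on the nose (`mem_limitSelmer_eisensteinSelmerStructure_iff`,
`limitSelmer_eisensteinSelmerStructure_eq`): a family `x ∈ Π_k H¹(K, T_𝔮/p^k)` is in the typed `limitSelmer F_𝔮` iff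
it is a compatible family (an element of the carrier of `eisensteinH1Limit`) lying in `ordinarySelmer`; and the
`Λ`-submodule form (`mem_selmerSubmodule …` via `ordinarySelmer_eq_toAddSubgroup_selmerSubmodule`). So the v9 stubs
of the shared μ-item may name `H_m` in either currency. Theorems only; nothing asserted; no `sorry`.
BSD is not proved by any of this.

References: [Howard2004HeegnerKolyvagin] §1.6 (arXiv p. 12, L29–55), Def. 1.1.10, Def. 3.1.2, §2.2 Def. 2.2.3.
-/

noncomputable section

open scoped TensorProduct ContRepresentation
open Field IsLocalRing IsDedekindDomain

namespace Literature.NumberTheory.EllipticCurves.ZpExtension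

open Literature.NumberTheory.GaloisRepresentations
open Literature.NumberTheory.GaloisCohomology.Howard2004
open scoped NumberField

variable {K : Type} [Field K] [NumberField K] {p : ℕ} [hp : Fact p.Prime] (κ : ZpExtension K p)
  {M : ℕ → Type} [∀ k, AddCommGroup (M k)] [∀ k, TopologicalSpace (M k)] [∀ k, DiscreteTopology (M k)]
  (ρ : ∀ k, DiscreteGaloisModule K (M k))
  (t : ∀ k, (ρ (k + 1)).toContRepresentation →ⁱL (ρ k).toContRepresentation)
  {m : ℕ} (hm : 1 ≤ m) (ht : ∀ k, Function.Surjective (t k))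
  (S : Finset (HeightOneSpectrum (𝓞 K)))
  (Φ : ∀ v : HeightOneSpectrum (𝓞 K), ((p : ℕ) : 𝓞 K) ∈ v.asIdeal → OrdinaryFiltration ρ t v)

/-- **Typed `limitSelmer F_𝔮` = pinned `ordinarySelmer` (membership form).** A family
`x ∈ Π_k H¹(K, T_𝔮/p^k T_𝔮)` lies in `(eisensteinAdicTower …).limitSelmer F_𝔮` iff it is compatible (an element of
`eisensteinH1LimitCarrier`, the carrier of the pinned `H¹(K, T_𝔮)`) and, as such, lies in
`(eisensteinH1Limit …).ordinarySelmer S Φ`. [cite: Howard2004HeegnerKolyvagin, §1.6 (arXiv p. 12, L29–55) and Def. 3.1.2] -/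
theorem mem_limitSelmer_eisensteinSelmerStructure_iff :
    letI := IwasawaAlgebra.isLocalRing_quotient_X_pow_add_C p hm
    ∀ x : ∀ k, galoisCohomology ((κ.eisensteinAdicTower ρ t hm ht).ρ k) 1,
      x ∈ (κ.eisensteinAdicTower ρ t hm ht).limitSelmer (fun k ↦ κ.eisensteinSelmerStructure ρ t hm S Φ k) ↔
        ∃ hx : x ∈ κ.eisensteinH1LimitCarrier ρ t hm,
          (⟨x, hx⟩ : (κ.eisensteinH1Limit ρ t hm).H) ∈ (κ.eisensteinH1Limit ρ t hm).ordinarySelmer S Φ := by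
  letI := IwasawaAlgebra.isLocalRing_quotient_X_pow_add_C p hm
  intro x
  refine (κ.mem_limitSelmer_eisensteinAdicTower_iff ρ t hm ht _ x).trans ⟨?_, ?_⟩
  · rintro ⟨hc, hsel⟩
    exact ⟨(κ.mem_eisensteinH1LimitCarrier_iff ρ t hm x).2 hc,
      ((κ.eisensteinH1Limit ρ t hm).mem_ordinarySelmer_iff S Φ _).2 fun k ↦ hsel k⟩
  · rintro ⟨hx, hsel⟩
    exact ⟨(κ.mem_eisensteinH1LimitCarrier_iff ρ t hm x).1 hx,
      fun k ↦ ((κ.eisensteinH1Limit ρ t hm).mem_ordinarySelmer_iff S Φ _).1 hsel k⟩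

/-- **Typed `limitSelmer F_𝔮` = pinned `ordinarySelmer` (as subgroups of `Π_k H¹(K, T_𝔮/p^k)`).**
[cite: Howard2004HeegnerKolyvagin, §1.6 (arXiv p. 12, L29–55) and Def. 3.1.2] -/
theorem limitSelmer_eisensteinSelmerStructure_eq :
    letI := IwasawaAlgebra.isLocalRing_quotient_X_pow_add_C p hm
    (κ.eisensteinAdicTower ρ t hm ht).limitSelmer (fun k ↦ κ.eisensteinSelmerStructure ρ t hm S Φ k) =
      ((κ.eisensteinH1Limit ρ t hm).ordinarySelmer S Φ).map (κ.eisensteinH1LimitCarrier ρ t hm).subtype := by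
  letI := IwasawaAlgebra.isLocalRing_quotient_X_pow_add_C p hm
  refine AddSubgroup.ext fun x ↦ (κ.mem_limitSelmer_eisensteinSelmerStructure_iff ρ t hm ht S Φ x).trans ?_
  refine Iff.trans ?_ AddSubgroup.mem_map.symm
  constructor
  · rintro ⟨hx, hsel⟩
    exact ⟨⟨x, hx⟩, hsel, rfl⟩
  · rintro ⟨h, hsel, rfl⟩
    exact ⟨h.2, hsel⟩

/-- **A pinned Selmer element gives a typed one**: for `h` in the pinned `H¹_{F_𝔮}(K, T_𝔮)`
(`ordinarySelmer` of `eisensteinH1Limit`) its family of projections lies in the typed `limitSelmer F_𝔮`.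
[cite: Howard2004HeegnerKolyvagin, §1.6 and Def. 3.1.2] -/
theorem coe_mem_limitSelmer_of_mem_ordinarySelmer {h : κ.eisensteinH1LimitCarrier ρ t hm}
    (hh : (h : (κ.eisensteinH1Limit ρ t hm).H) ∈ (κ.eisensteinH1Limit ρ t hm).ordinarySelmer S Φ) :
    letI := IwasawaAlgebra.isLocalRing_quotient_X_pow_add_C p hm
    (h : Π k, galoisCohomology (κ.eisensteinTwist (ρ k) hm k) 1) ∈
      (κ.eisensteinAdicTower ρ t hm ht).limitSelmer (fun k ↦ κ.eisensteinSelmerStructure ρ t hm S Φ k) :=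
  (κ.mem_limitSelmer_eisensteinSelmerStructure_iff ρ t hm ht S Φ _).2 ⟨h.2, hh⟩

/-- The same for the `Λ`-SUBMODULE form of the pinned Selmer module (`EisensteinH1Data.selmerSubmodule F_𝔮 _`, whose
underlying subgroup is `ordinarySelmer`, `ordinarySelmer_eq_toAddSubgroup_selmerSubmodule`).
[cite: Howard2004HeegnerKolyvagin, §1.6 and Prop. 3.1.3 (H¹_{F_𝔮}(K, T_𝔮) is an S_𝔮-module)] -/
theorem mem_limitSelmer_iff_mem_selmerSubmodule (h : κ.eisensteinH1LimitCarrier ρ t hm) :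
    letI := IwasawaAlgebra.isLocalRing_quotient_X_pow_add_C p hm
    (h : Π k, galoisCohomology (κ.eisensteinTwist (ρ k) hm k) 1) ∈
        (κ.eisensteinAdicTower ρ t hm ht).limitSelmer (fun k ↦ κ.eisensteinSelmerStructure ρ t hm S Φ k) ↔
      (h : (κ.eisensteinH1Limit ρ t hm).H) ∈
        (κ.eisensteinH1Limit ρ t hm).selmerSubmodule (κ.eisensteinSelmerStructure ρ t hm S Φ)
          (fun k c x hx ↦ κ.map_eisensteinTwistSMulHom_mem_selmerGroup ρ t hm S Φ k c x hx) := by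
  letI := IwasawaAlgebra.isLocalRing_quotient_X_pow_add_C p hm
  refine (κ.mem_limitSelmer_eisensteinSelmerStructure_iff ρ t hm ht S Φ _).trans ?_
  refine Iff.trans ?_ ((κ.eisensteinH1Limit ρ t hm).mem_selmerSubmodule_eisensteinSelmerStructure_iff S Φ _).symm
  exact ⟨fun ⟨_, hsel⟩ ↦ hsel, fun hsel ↦ ⟨h.2, hsel⟩⟩

end Literature.NumberTheory.EllipticCurves.ZpExtension

end
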